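import Mathlib
import Literature.Barriers.ValiantsHypothesis.AlgebraicNaturalProofs
import Summits.ValiantsHypothesis.ValiantsHypothesis.Theorems.BarrierLeverSuccinctHittingSetsForVPCentralBinomialTwoWitness
import Summits.ValiantsHypothesis.ValiantsHypothesis.Theorems.BarrierLeverSuccinctHittingSetsForVPStubRisingDiagonal
import Summits.ValiantsHypothesis.ValiantsHypothesis.Theorems.BarrierLeverSuccinctHittingSetsForVPStubPrincipalMinors
import HarnessLib

/-!
# Crux `BarrierLever.SuccinctHittingSetsForVP` (stmt-ValiantsHypothesis-14610) side, row
'PrincipalMinors' AT THE OPEN RUNG `b = 2`: EVERY principal catalecticant minor is nonsingular at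
ONE member of `SmallCircuits ℂ n 2` (seat val-np-p5)

**What is proved (unconditional; evidence for the open item 14610 in the direction the crux predicts
for rank methods; it does NOT close any item).** The tree's rows `stub_principalMinors`
(exponent `8`) and `principalMinors_three` (exponent `3`, `n ≥ 6`) move to the open rung:

* `principalMinors_two` : for `n ≥ 8192` ONE `f ∈ SmallCircuits ℂ n 2` — the central-binomial
  witness `W_n = Σ_{|m| ≤ n} (∏_l C(2m_l, m_l)) x^m` of `…CentralBinomialTwoWitness.lean`
  (size `≤ n²` by the FFT product tree + Newton iteration for `P^{-1/2}`) — has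
  `det [coeff_{u_i + u_j} f] ≠ 0` for EVERY finite injective family `u` with `2|u_i| ≤ n`
  (any size, any mixture of degrees);
* `principalMinorsHit_two` / `principalMinorsHit_of_two_le` / `not_isNaturalProof_principalMinor_two`:
  hence `SmallCircuits ℂ n b`, every `b ≥ 2`, succinctly hits all principal catalecticant minors
  and none of them is an algebraically natural proof against it.

**Proof of nonsingularity** (Gram, as in `PrincipalMinors.det_of_prod_factorial_ne_zero`): the
Hankel matrix of central binomial coefficients factorises over `ℤ`,
`C(2(a+b), a+b) = Σ_{t ∈ ℤ} C(2a, a+t) C(2b, b+t)` (Vandermonde, `CentralBinomialTwo.sum_gcol_mul`),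
so `[∏_l C(2(u_i l + u_j l), u_i l + u_j l)] = G Gᵀ` with `G[i, t] = ∏_l C(2 u_i l, u_i l + t_l)`
(`t_l ∈ [-N, N]`); the rows of `G` indexed by distinct exponent vectors are independent (the column
`t = u_{i₀}` for `i₀ ∈ supp v` of maximal degree is supported on the single row `i₀`:
`C(2a, a + t) = 0` for `t > a`, `= 1` for `t = a`).

Honest framing: a `b = 2` hitting-set statement for one classical rank method (principal
catalecticant minors); nothing here bears on the dense heart of 14610 or on VP ≠ VNP.

References: Sylvester 1851/52 (catalecticants); [ForbesShpilkaVolk2018] §1.2 (rank methods are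
algebraically natural), Question 6; von zur Gathen–Gerhard §8–10 (the fast arithmetic).
-/

-- layout Summits/ValiantsHypothesis/ValiantsHypothesis forces the duplicated namespace component
set_option linter.dupNamespace false

noncomputable section

namespace Summit.ValiantsHypothesis.ValiantsHypothesis.Theorems.BarrierLever.SuccinctHittingSetsForVP

open Literature.Barriers.ValiantsHypothesis Literature.Computability.AlgebraicComplexity MvPolynomial

namespace CentralBinomialTwo

open Finset

/-! ### The Gram factorisation of the central-binomial Hankel matrix -/

/-- The Gram column entries `g_N(a, s) = C(2a, a + s − N)` for `s ∈ [0, 2N]` (the column index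
`s` encodes `t = s − N ∈ [−N, N]`; zero when `a + s < N`). [folklore] -/
def gcol (N a s : ℕ) : ℕ := if N ≤ a + s then (2 * a).choose (a + s - N) else 0

/-- **`C(2(a+b), a+b) = Σ_{s ≤ 2N} g_N(a, s) g_N(b, s)`** for `a, b ≤ N` (Vandermonde's identity
`C(2a+2b, a+b) = Σ_i C(2a, i) C(2b, a+b−i)`, re-indexed by `i = a + s − N` and using
`C(2b, a+b−i) = C(2b, b+i−a)`). [folklore] -/
theorem sum_gcol_mul (N a b : ℕ) (ha : a ≤ N) (hb : b ≤ N) :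
    ∑ s ∈ range (2 * N + 1), gcol N a s * gcol N b s = (2 * (a + b)).choose (a + b) := by
  -- restrict to the window `s ∈ [N − a, N + b]`
  have hwin : ∑ s ∈ range (2 * N + 1), gcol N a s * gcol N b s =
      ∑ s ∈ Ico (N - a) (N + b + 1), gcol N a s * gcol N b s := by
    refine (sum_subset (fun s hs => ?_) (fun s hs hns => ?_)).symm
    · rw [mem_Ico] at hs; rw [mem_range]; omega
    · rw [mem_Ico, not_and_or, not_le, not_lt] at hns
      rcases hns with h | h
      · simp [gcol, show ¬ N ≤ a + s by omega]
      · have : gcol N b s = 0 := by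
          simp only [gcol]
          rw [if_pos (by omega), Nat.choose_eq_zero_of_lt (by omega)]
        rw [this, mul_zero]
  rw [hwin, show N + b + 1 = (N - a) + (a + b + 1) by omega, Finset.sum_Ico_eq_sum_range,
    show (N - a) + (a + b + 1) - (N - a) = a + b + 1 by omega, mul_add, Nat.add_choose_eq,
    Finset.Nat.sum_antidiagonal_eq_sum_range_succ_mk]
  refine sum_congr rfl fun i hi => ?_
  rw [mem_range] at hi
  have h1 : gcol N a (N - a + i) = (2 * a).choose i := by
    simp only [gcol]
    rw [if_pos (by omega)]
    congr 1; omega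
  have h2 : gcol N b (N - a + i) = (2 * b).choose (a + b - i) := by
    simp only [gcol]
    by_cases h : a ≤ b + i
    · rw [if_pos (by omega), show b + (N - a + i) - N = b + i - a by omega,
        ← Nat.choose_symm (show a + b - i ≤ 2 * b by omega)]
      congr 1; omega
    · rw [if_neg (by omega), Nat.choose_eq_zero_of_lt (by omega)]
  rw [h1, h2]

/-- `g_N(a, N + t) = C(2a, a + t)`: zero for `t > a`. [folklore] -/
theorem gcol_shift_eq_zero {N a t : ℕ} (h : a < t) : gcol N a (N + t) = 0 := by
  simp only [gcol]
  rw [if_pos (by omega), Nat.choose_eq_zero_of_lt (by omega)]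

/-- `g_N(a, N + a) = 1`. [folklore] -/
theorem gcol_shift_self (N a : ℕ) : gcol N a (N + a) = 1 := by
  simp only [gcol]
  rw [if_pos (by omega), show a + (N + a) - N = 2 * a by omega, Nat.choose_self]

/-- The Gram identity summed over the column type `Fin (2N + 1)`, cast to `ℚ`. [folklore] -/
theorem sum_fin_gcol_mul (N a b : ℕ) (ha : a ≤ N) (hb : b ≤ N) :
    ∑ s : Fin (2 * N + 1), ((gcol N a s : ℕ) : ℚ) * ((gcol N b s : ℕ) : ℚ) =
      ((2 * (a + b)).choose (a + b) : ℚ) := by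
  rw [Fin.sum_univ_eq_sum_range (fun s => ((gcol N a s : ℕ) : ℚ) * ((gcol N b s : ℕ) : ℚ)),
    ← sum_gcol_mul N a b ha hb, Nat.cast_sum]
  simp [Nat.cast_mul]

/-- **The multivariate Gram identity** `Σ_j G[u, j] G[w, j] = ∏_l C(2(u_l + w_l), u_l + w_l)` for
`G[u, j] = ∏_l g_N(u_l, j_l)`, columns `j : Fin n → Fin (2N + 1)`, whenever `u, w ≤ N` pointwise.
[folklore] -/
theorem sum_prod_gcol {n N : ℕ} (u w : Fin n →₀ ℕ) (hu : ∀ l, u l ≤ N) (hw : ∀ l, w l ≤ N) :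
    ∑ j : Fin n → Fin (2 * N + 1),
        (∏ l, ((gcol N (u l) (j l) : ℕ) : ℚ)) * ∏ l, ((gcol N (w l) (j l) : ℕ) : ℚ) =
      ∏ l, (((2 * ((u + w) l)).choose ((u + w) l) : ℕ) : ℚ) := by
  calc ∑ j : Fin n → Fin (2 * N + 1),
        (∏ l, ((gcol N (u l) (j l) : ℕ) : ℚ)) * ∏ l, ((gcol N (w l) (j l) : ℕ) : ℚ)
      = ∑ j : Fin n → Fin (2 * N + 1),
          ∏ l, (((gcol N (u l) (j l) : ℕ) : ℚ) * ((gcol N (w l) (j l) : ℕ) : ℚ)) :=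
        sum_congr rfl fun j _ => prod_mul_distrib.symm
    _ = ∏ l, ∑ s : Fin (2 * N + 1), (((gcol N (u l) s : ℕ) : ℚ) * ((gcol N (w l) s : ℕ) : ℚ)) :=
        (Fintype.prod_sum (fun l (s : Fin (2 * N + 1)) =>
          ((gcol N (u l) s : ℕ) : ℚ) * ((gcol N (w l) s : ℕ) : ℚ))).symm
    _ = ∏ l, (((2 * ((u + w) l)).choose ((u + w) l) : ℕ) : ℚ) :=
        prod_congr rfl fun l _ => by rw [sum_fin_gcol_mul N (u l) (w l) (hu l) (hw l)]; rfl

/-- **`R = G Gᵀ`**: the principal catalecticant block `R[i, j] = ∏_l C(2(u_i l + u_j l), …)` of the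
central-binomial witness is the Gram matrix of the rows of `G[i, t] = ∏_l g_N(u_i l, t_l)`.
[folklore] -/
theorem of_prod_centralBinom_eq_mul_transpose {n N : ℕ} {ι : Type*} [Fintype ι]
    (u : ι → (Fin n →₀ ℕ)) (hu : ∀ i l, u i l ≤ N) :
    (Matrix.of fun i j : ι => ∏ l, (((2 * ((u i + u j) l)).choose ((u i + u j) l) : ℕ) : ℚ)) =
      (Matrix.of fun (i : ι) (t : Fin n → Fin (2 * N + 1)) =>
          ∏ l, ((gcol N (u i l) (t l) : ℕ) : ℚ)) *
        (Matrix.of fun (i : ι) (t : Fin n → Fin (2 * N + 1)) =>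
          ∏ l, ((gcol N (u i l) (t l) : ℕ) : ℚ)).transpose := by
  ext i j
  rw [Matrix.mul_apply]
  simp only [Matrix.of_apply, Matrix.transpose_apply]
  exact (sum_prod_gcol (u i) (u j) (hu i) (hu j)).symm

/-- The entry `G[u, N + u₀] = ∏_l C(2u_l, u_l + u₀ l)` vanishes unless `u₀ ≤ u` coordinatewise.
[folklore] -/
theorem prod_gcol_eq_zero_of_not_le {n N : ℕ} {u u₀ : Fin n →₀ ℕ} (h : ¬ ∀ l, u₀ l ≤ u l) :
    ∏ l, ((gcol N (u l) (N + u₀ l) : ℕ) : ℚ) = 0 := by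
  obtain ⟨l, hl⟩ := not_forall.mp h
  exact prod_eq_zero (mem_univ l) (by rw [gcol_shift_eq_zero (not_le.mp hl), Nat.cast_zero])

/-- `G[u₀, N + u₀] = 1`. [folklore] -/
theorem prod_gcol_self {n N : ℕ} (u₀ : Fin n →₀ ℕ) :
    ∏ l, ((gcol N (u₀ l) (N + u₀ l) : ℕ) : ℚ) = 1 :=
  prod_eq_one fun l _ => by rw [gcol_shift_self, Nat.cast_one]

/-- **The rows of `G` indexed by distinct exponent vectors are independent**: `v ᵥ* G = 0 → v = 0`
(evaluate at the column `t = N + u_{i₀}` for an `i₀ ∈ supp v` of maximal degree).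
[folklore] -/
theorem eq_zero_of_vecMul_eq_zero' {n N : ℕ} {ι : Type*} [Fintype ι] (u : ι → (Fin n →₀ ℕ))
    (hinj : Function.Injective u) (hu : ∀ i l, u i l ≤ N) (v : ι → ℚ)
    (hv : Matrix.vecMul v
        (Matrix.of fun (i : ι) (t : Fin n → Fin (2 * N + 1)) =>
          ∏ l, ((gcol N (u i l) (t l) : ℕ) : ℚ)) = 0) :
    v = 0 := by
  classical
  by_contra hne
  obtain ⟨i₁, hi₁⟩ := Function.ne_iff.mp hne
  obtain ⟨i₀, hi₀, hmax⟩ := exists_max_image (univ.filter fun i => v i ≠ 0)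
    (fun i => (u i).degree) ⟨i₁, mem_filter.mpr ⟨mem_univ _, hi₁⟩⟩
  have hv₀ : v i₀ ≠ 0 := (mem_filter.mp hi₀).2
  have hlt : ∀ l, N + u i₀ l < 2 * N + 1 := fun l => by have := hu i₀ l; omega
  have h := congrFun hv (fun l => ⟨N + u i₀ l, hlt l⟩)
  simp only [Matrix.vecMul, dotProduct, Matrix.of_apply, Pi.zero_apply] at h
  rw [sum_eq_single i₀] at h
  · exact hv₀ ((mul_eq_zero.mp h).resolve_right (by rw [prod_gcol_self]; exact one_ne_zero))
  · intro i _ hi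
    by_cases hvi : v i = 0
    · rw [hvi, zero_mul]
    · have hnle : ¬ ∀ l, u i₀ l ≤ u i l := fun hle =>
        hi (hinj (RisingDiagonal.eq_of_forall_le_of_degree_eq hle (le_antisymm
          (hmax i (mem_filter.mpr ⟨mem_univ _, hvi⟩))
          (PrincipalMinors.degree_le_degree_of_forall_le hle))))
      rw [prod_gcol_eq_zero_of_not_le hnle, mul_zero]
  · intro h'
    exact absurd (mem_univ i₀) h'

/-- **Every principal catalecticant minor of the central-binomial polynomial is nonsingular**
(over `ℚ`): `det [∏_l C(2(u_i l + u_j l), u_i l + u_j l)]_{i, j} ≠ 0` for injective `u` — a kernel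
vector `v` of `R = G Gᵀ` has `‖v ᵥ* G‖² = vᵀ R v = 0`, hence `v ᵥ* G = 0`, hence `v = 0`.
[folklore] -/
theorem det_of_prod_centralBinom_ne_zero {n : ℕ} {ι : Type*} [Fintype ι] [DecidableEq ι]
    (u : ι → (Fin n →₀ ℕ)) (hinj : Function.Injective u) :
    (Matrix.of fun i j : ι =>
      ∏ l, (((2 * ((u i + u j) l)).choose ((u i + u j) l) : ℕ) : ℚ)).det ≠ 0 := by
  intro hdet
  obtain ⟨v, hv0, hv⟩ := Matrix.exists_mulVec_eq_zero_iff.mpr hdet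
  have hu : ∀ i l, u i l ≤ univ.sup fun i => (u i).degree := fun i l =>
    (Finsupp.le_degree l (u i)).trans (le_sup (f := fun i => (u i).degree) (mem_univ i))
  rw [of_prod_centralBinom_eq_mul_transpose u hu, ← Matrix.mulVec_mulVec,
    Matrix.mulVec_transpose] at hv
  have h := congrArg (dotProduct v) hv
  rw [dotProduct_zero, Matrix.dotProduct_mulVec, dotProduct_self_eq_zero] at h
  exact hv0 (eq_zero_of_vecMul_eq_zero' u hinj hu v h)

end CentralBinomialTwo

open CentralBinomialTwo in
/-- **Row 'PrincipalMinors' at the open rung `b = 2`** (crux stmt-ValiantsHypothesis-14610, line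
`registered`; tree: `stub_principalMinors` exponent `8`, `principalMinors_three` exponent `3`): for
`n ≥ 8192` some `f ∈ SmallCircuits ℂ n 2` — the central-binomial witness
`W_n = Σ_{|m| ≤ n} (∏_l C(2m_l, m_l)) x^m`, of size `≤ n²` by FFT product tree + Newton iteration —
has `det [coeff_{u_i + u_j} f]_{i, j} ≠ 0` for EVERY finite injective family `u : ι ↪ ℕ^n` with
`2|u_i| ≤ n`: every principal catalecticant minor, of any size and any selection of rows, is the
positive-definite Gram matrix `[∏_l C(2(u_i l + u_j l), u_i l + u_j l)]`, hence is hit by one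
circuit of size `n²`. [cite: ForbesShpilkaVolk2018, §1.2] -/
theorem principalMinors_two :
    ∀ n : ℕ, 8192 ≤ n → ∃ f ∈ SmallCircuits ℂ n 2,
      ∀ (ι : Type) [Fintype ι] [DecidableEq ι] (u : ι → (Fin n →₀ ℕ)), Function.Injective u →
        (∀ i, 2 * (u i).degree ≤ n) →
        (Matrix.of fun i j : ι => MvPolynomial.coeff (u i + u j) f).det ≠ 0 := by
  intro n hn
  refine ⟨witness n, witness_mem_smallCircuits n hn, ?_⟩
  intro ι _ _ u hinj hdeg
  have hM : (Matrix.of fun i j : ι => MvPolynomial.coeff (u i + u j) (witness n)) =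
      (Matrix.of fun i j : ι =>
        ∏ l, (((2 * ((u i + u j) l)).choose ((u i + u j) l) : ℕ) : ℚ)).map
        (fun x : ℚ => (x : ℂ)) := by
    ext i j
    have hd : (u i + u j).degree ≤ n := by
      rw [map_add]
      have hi := hdeg i
      have hj := hdeg j
      omega
    simp only [Matrix.map_apply, Matrix.of_apply, Rat.cast_prod, Rat.cast_natCast]
    rw [coeff_witness, if_pos hd]
  rw [hM, ← Rat.cast_det, Rat.cast_ne_zero]
  exact det_of_prod_centralBinom_ne_zero u hinj

/-- **Hitting-set form**: for `n ≥ 8192`, `SmallCircuits ℂ n 2` is a succinct hitting set for every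
polynomial in the coefficient variables whose value at every coefficient vector is a principal
catalecticant minor `det [coeff_{u_i + u_j} f]` (`u` injective, `2|u_i| ≤ n`) — one witness for all
of them (tree: `stub_principalMinorsHit`, exponent `8`; `principalMinorsHit_three`, exponent `3`).
[cite: ForbesShpilkaVolk2018, §1.2] -/
theorem principalMinorsHit_two :
    ∀ n : ℕ, 8192 ≤ n →
      IsSuccinctHittingSet (degLEMonomials n) (SmallCircuits ℂ n 2)
        {D | ∃ (ι : Type) (_ : Fintype ι) (_ : DecidableEq ι) (u : ι → (Fin n →₀ ℕ)),
          Function.Injective u ∧ (∀ i, 2 * (u i).degree ≤ n) ∧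
          ∀ f : MvPolynomial (Fin n) ℂ, MvPolynomial.eval (coeffVector (degLEMonomials n) f) D =
            (Matrix.of fun i j : ι => MvPolynomial.coeff (u i + u j) f).det} := by
  intro n hn
  obtain ⟨f, hf, hdet⟩ := principalMinors_two n hn
  intro D hD _
  obtain ⟨ι, _, _, u, hinj, hdeg, hD⟩ := hD
  refine ⟨f, hf, ?_⟩
  rw [hD f]
  exact hdet ι u hinj hdeg

/-- … hence the same holds inside `SmallCircuits ℂ n b` for EVERY `b ≥ 2` (`n ≥ 8192`): the whole
principal-catalecticant-minor family of rank methods is succinctly hit from the open rung on.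
[cite: ForbesShpilkaVolk2018, §1.2] -/
theorem principalMinorsHit_of_two_le {n b : ℕ} (hn : 8192 ≤ n) (hb : 2 ≤ b) :
    IsSuccinctHittingSet (degLEMonomials n) (SmallCircuits ℂ n b)
      {D | ∃ (ι : Type) (_ : Fintype ι) (_ : DecidableEq ι) (u : ι → (Fin n →₀ ℕ)),
        Function.Injective u ∧ (∀ i, 2 * (u i).degree ≤ n) ∧
        ∀ f : MvPolynomial (Fin n) ℂ, MvPolynomial.eval (coeffVector (degLEMonomials n) f) D =
          (Matrix.of fun i j : ι => MvPolynomial.coeff (u i + u j) f).det} :=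
  (principalMinorsHit_two n hn).mono (smallCircuits_mono ℂ hb (by omega)) le_rfl

/-- **No principal-catalecticant-minor natural proof against `SmallCircuits ℂ n b`, `b ≥ 2`**
(`n ≥ 8192`): a distinguisher whose value is such a minor vanishes somewhere it should not.
[cite: ForbesShpilkaVolk2018, Thm. 4] -/
theorem not_isNaturalProof_principalMinor_two {n b : ℕ} (hn : 8192 ≤ n) (hb : 2 ≤ b)
    (𝒟 : Set (MvPolynomial (degLEMonomials n) ℂ)) {D : MvPolynomial (degLEMonomials n) ℂ}
    (hD : ∃ (ι : Type) (_ : Fintype ι) (_ : DecidableEq ι) (u : ι → (Fin n →₀ ℕ)),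
      Function.Injective u ∧ (∀ i, 2 * (u i).degree ≤ n) ∧
      ∀ f : MvPolynomial (Fin n) ℂ, MvPolynomial.eval (coeffVector (degLEMonomials n) f) D =
        (Matrix.of fun i j : ι => MvPolynomial.coeff (u i + u j) f).det) :
    ¬ IsNaturalProof (degLEMonomials n) (SmallCircuits ℂ n b) 𝒟 D := by
  rintro ⟨-, hD0, hvan⟩
  obtain ⟨f, hf, hne⟩ := principalMinorsHit_of_two_le hn hb D hD hD0
  exact hne (hvan f hf)

end Summit.ValiantsHypothesis.ValiantsHypothesis.Theorems.BarrierLever.SuccinctHittingSetsForVP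

end
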